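import Summits.PneNP.PneNP.Theorems.ConvexRankGatesLinAlgGateBlindKonigIsGRank
import Summits.PneNP.PneNP.Theorems.ConvexRankGatesLinAlgGateBlindTutteKernel

/-!
# Route ConvexRankGates, crux `LinAlgGateBlind` (stmt-PneNP-10681): TUTTE gates are GRANK gates of the same dimension (Tutte 1947 in gate form)

Support theorem for the crux. The crux's definition of GRANK gates (`IsGRankGate`) cites Tutte 1947 for the skew-symmetric
version of Edmonds' criterion, and `Capture` lists "general perfect matching — one Tutte-matrix GRANK gate" among its
witnesses. `isGRankGate_of_tutteGate` proves it for the inline class `TUTTE_d` of the Tutte door (`…TutteLogWidth`): a gate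
accepting `v` iff the graph on `[d]` spanned by the cells `P₀ ∪ ⋃_{v_i = 1} P_i` has a perfect matching is a GRANK gate of every
dimension `s ≥ d`, with threshold `θ = d`, over `ℚ(t_{o,c} : o ∈ {0} ⊔ [n], c ∈ [d]²)`: `K₀ = (t_{0,(a,b)}[(a,b) ∈ P₀] -
t_{0,(b,a)}[(b,a) ∈ P₀])`, `K_i = (t_{i,(a,b)}[(a,b) ∈ P_i] - t_{i,(b,a)}[(b,a) ∈ P_i])` (generic SKEW data). A perfect
matching gives `det ≠ 0` by specialising every indeterminate to the indicator of "chosen cell of a matching edge, with its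
owner": the matrix becomes `S = ∑_{edges} ±(E_{ab} - E_{ba})` with `S² = -1`; no perfect matching gives `det = 0` for the
skew-symmetric symbolic matrix supported on the live graph (`det_eq_zero_of_forall_not_isPerfectMatching`, from Tutte's
theorem), hence rank `< d`. So the Tutte door is a GRANK door: GRANK gates of the Tutte type are blind to `CLIQUE(m, ⌈m^{1/8}⌉)`
up to dimension `m^{7/8-o(1)}` (`not_computes_clique_of_isOver_tutte_logWidth`), against `m^{7/16-o(1)}` for general GRANK.
Source: W. T. Tutte, The factorization of linear graphs, J. London Math. Soc. 22 (1947). No new definitions. [folklore]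
-/

-- `Summit.PneNP.PneNP.…` duplicates `PneNP` BY DESIGN (single-problem summit).
set_option linter.dupNamespace false

namespace Summit.PneNP.PneNP.Theorems

open Finset MvPolynomial Literature.Computability.Complexity

/-- **TUTTE gates are GRANK gates of the same dimension** (Tutte 1947, in gate form; see the module docstring). [folklore] -/
theorem isGRankGate_of_tutteGate : ∀ {n d s : ℕ}, d ≤ s → ∀ (P₀ : Set (Fin d × Fin d)) (P : Fin n → Set (Fin d × Fin d))
    {f : (Fin n → Bool) → Bool},
    (∀ v, f v = true ↔ ∃ M : (SimpleGraph.fromRel fun a b : Fin d =>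
      (a, b) ∈ {x : Fin d × Fin d | x ∈ P₀ ∨ ∃ i, v i = true ∧ x ∈ P i}).Subgraph, M.IsPerfectMatching) →
    IsGRankGate s ⟨n, f⟩ := by
  intro n d s hd P₀ P f hf
  classical
  -- generic skew entries: one indeterminate per (owner, cell); owner `none` is the constant pattern `P₀`
  let R₀ : Type := MvPolynomial (Option (Fin n) × (Fin d × Fin d)) ℚ
  let L : Type := FractionRing R₀
  let ι : R₀ →+* L := algebraMap R₀ L
  have hι : Function.Injective ι := IsFractionRing.injective R₀ L
  let K₀' : Matrix (Fin d) (Fin d) R₀ := Matrix.of fun a b =>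
    P₀.indicator (fun x => (X (none, x) : R₀)) (a, b) - P₀.indicator (fun x => (X (none, x) : R₀)) (b, a)
  let K' : Fin n → Matrix (Fin d) (Fin d) R₀ := fun i => Matrix.of fun a b =>
    (P i).indicator (fun x => (X (some i, x) : R₀)) (a, b) - (P i).indicator (fun x => (X (some i, x) : R₀)) (b, a)
  have hK₀ba : ∀ a b, K₀' b a = -K₀' a b := fun a b => by
    simp only [K₀', Matrix.of_apply]; ring
  have hK'ba : ∀ i a b, K' i b a = -K' i a b := fun i a b => by
    simp only [K', Matrix.of_apply]; ring
  refine ⟨L, inferInstance, d, d, hd, K₀'.map ι, fun i => (K' i).map ι, fun v => ?_⟩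
  show f v = true ↔ _
  rw [hf v]
  constructor
  · -- a perfect matching gives a non-zero determinant
    rintro ⟨Mm, hMm⟩
    refine (Literature.LinearAlgebra.Matrix.le_rank_iff_exists_det_submatrix_ne_zero _).2 ⟨id, id, ?_⟩
    apply det_submatrix_symbolicMatrix_ne_zero_of_eval
    have hmap : ((K₀'.map ι + ∑ i, if v i then (K' i).map ι else 0) :
        Matrix (Fin d) (Fin d) L) = (K₀' + ∑ i, if v i then K' i else 0).map ι := by
      ext a b
      simp only [Matrix.add_apply, Matrix.map_apply, Matrix.sum_apply, map_add, map_sum]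
      congr 1
      refine Finset.sum_congr rfl fun i _ => ?_
      split_ifs <;> simp [Matrix.map_apply]
    rw [hmap, Matrix.submatrix_map, ← RingHom.mapMatrix_apply, ← RingHom.map_det]
    refine (map_ne_zero_iff _ hι).2 ?_
    rw [Matrix.submatrix_id_id]
    -- the matching involution `σ`
    have hpartner : ∀ a : Fin d, ∃ b, Mm.Adj a b ∧ ∀ b', Mm.Adj a b' → b' = b := fun a => by
      obtain ⟨b, hb, huniq⟩ := hMm.1 (hMm.2 a)
      exact ⟨b, hb, huniq⟩
    choose σ hσadj hσuniq using hpartner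
    have hσσ : ∀ a, σ (σ a) = a := fun a => (hσuniq (σ a) a (Mm.adj_symm (hσadj a))).symm
    have hne : ∀ a, a ≠ σ a := fun a h => (Mm.adj_sub (hσadj a)).ne h
    -- a live witness (owner, cell) on every matching edge
    have hw : ∀ a, ∃ oc : Option (Fin n) × (Fin d × Fin d), (oc.2 = (a, σ a) ∨ oc.2 = (σ a, a)) ∧
        ((oc.1 = none ∧ oc.2 ∈ P₀) ∨ ∃ i, oc.1 = some i ∧ v i = true ∧ oc.2 ∈ P i) := by
      intro a
      have hadj := Mm.adj_sub (hσadj a)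
      rw [SimpleGraph.fromRel_adj] at hadj
      rcases hadj.2 with (h0 | ⟨i, hi, hP⟩) | (h0 | ⟨i, hi, hP⟩)
      · exact ⟨(none, (a, σ a)), Or.inl rfl, Or.inl ⟨rfl, h0⟩⟩
      · exact ⟨(some i, (a, σ a)), Or.inl rfl, Or.inr ⟨i, rfl, hi, hP⟩⟩
      · exact ⟨(none, (σ a, a)), Or.inr rfl, Or.inl ⟨rfl, h0⟩⟩
      · exact ⟨(some i, (σ a, a)), Or.inr rfl, Or.inr ⟨i, rfl, hi, hP⟩⟩
    choose wit hwit_cell hwit_own using hw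
    -- the smaller endpoint represents its edge; representatives with the same cell coincide
    have hrep : ∀ a a', a < σ a → a' < σ a' → (wit a).2 = (wit a').2 → a = a' := by
      intro a a' ha ha' h
      rcases hwit_cell a with hc | hc <;> rcases hwit_cell a' with hc' | hc' <;> rw [hc, hc'] at h <;>
        simp only [Prod.mk.injEq] at h
      · exact h.1
      · exfalso
        obtain ⟨h1, h2⟩ := h
        rw [h2] at ha
        rw [h1] at ha
        exact lt_irrefl _ (ha.trans ha')
      · exfalso
        obtain ⟨h1, h2⟩ := h
        rw [← h2] at ha'
        rw [h1] at ha
        exact lt_irrefl _ (ha.trans ha')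
      · exact h.2
    -- chosen cells and the specialisation
    let CL : Set (Fin d × Fin d) := {c | ∃ a, a < σ a ∧ (wit a).2 = c}
    let ω : Option (Fin n) × (Fin d × Fin d) → ℚ := fun p => if ∃ a, a < σ a ∧ wit a = p then 1 else 0
    -- `ω` on a chosen cell singles out its owner; off the chosen cells it vanishes
    have hω_mem : ∀ a₀, a₀ < σ a₀ → ∀ o : Option (Fin n), ω (o, (wit a₀).2) = if o = (wit a₀).1 then 1 else 0 := by
      intro a₀ ha₀ o
      simp only [ω]
      congr 1
      refine propext ⟨?_, ?_⟩
      · rintro ⟨a, ha, hwa⟩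
        have h2 : (wit a).2 = (wit a₀).2 := by rw [hwa]
        obtain rfl := hrep a a₀ ha ha₀ h2
        exact (congrArg Prod.fst hwa).symm
      · rintro rfl
        exact ⟨a₀, ha₀, Prod.ext rfl rfl⟩
    have hω_off : ∀ c, c ∉ CL → ∀ o : Option (Fin n), ω (o, c) = 0 := by
      intro c hc o
      simp only [ω]
      rw [if_neg]
      rintro ⟨a, ha, hwa⟩
      exact hc ⟨a, ha, by rw [hwa]⟩
    -- the total specialised weight of a cell
    let Φ : Fin d × Fin d → ℚ := fun c =>
      (if c ∈ P₀ then ω (none, c) else 0) + ∑ i, if v i then (if c ∈ P i then ω (some i, c) else 0) else 0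
    have hΦ : ∀ c, Φ c = if c ∈ CL then 1 else 0 := by
      intro c
      by_cases hc : c ∈ CL
      · rw [if_pos hc]
        obtain ⟨a₀, ha₀, rfl⟩ := hc
        simp only [Φ, hω_mem a₀ ha₀]
        rcases hwit_own a₀ with ⟨ho, hP0⟩ | ⟨i₀, ho, hv, hP⟩
        · rw [if_pos hP0, if_pos ho.symm, Finset.sum_eq_zero, add_zero]
          intro i _
          have : (some i : Option (Fin n)) ≠ (wit a₀).1 := by rw [ho]; exact Option.some_ne_none i
          simp [this]
        · rw [Finset.sum_eq_single i₀]
          · simp [hv, hP, ho]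
          · intro i _ hi
            have : (some i : Option (Fin n)) ≠ (wit a₀).1 := by
              rw [ho]; exact fun h => hi (Option.some_injective _ h)
            simp [this]
          · simp
      · rw [if_neg hc]
        simp only [Φ, hω_off c hc, ite_self, Finset.sum_const_zero, add_zero]
    -- the specialised matrix `E`
    let E : Fin d → Fin d → ℚ := fun a b => (if (a, b) ∈ CL then 1 else 0) - (if (b, a) ∈ CL then 1 else 0)
    have hsum : ∀ a b, (∑ i, if v i then K' i else (0 : Matrix (Fin d) (Fin d) R₀)) a b =
        ∑ i, if v i then K' i a b else 0 := by
      intro a b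
      rw [Matrix.sum_apply]
      refine Finset.sum_congr rfl fun i _ => ?_
      split_ifs <;> rfl
    have hK₀eval : ∀ a b, MvPolynomial.eval ω (K₀' a b) =
        (if (a, b) ∈ P₀ then ω (none, (a, b)) else 0) - (if (b, a) ∈ P₀ then ω (none, (b, a)) else 0) := by
      intro a b
      simp only [K₀', Matrix.of_apply, Set.indicator_apply, map_sub, apply_ite (MvPolynomial.eval ω), eval_X, map_zero]
    have hK'eval : ∀ i a b, MvPolynomial.eval ω (K' i a b) =
        (if (a, b) ∈ P i then ω (some i, (a, b)) else 0) - (if (b, a) ∈ P i then ω (some i, (b, a)) else 0) := by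
      intro i a b
      simp only [K', Matrix.of_apply, Set.indicator_apply, map_sub, apply_ite (MvPolynomial.eval ω), eval_X, map_zero]
    have hentry : ∀ a b, (RingHom.mapMatrix (MvPolynomial.eval ω)) (K₀' + ∑ i, if v i then K' i else 0) a b = E a b := by
      intro a b
      have hE : E a b = Φ (a, b) - Φ (b, a) := by simp only [E, hΦ]
      rw [hE, RingHom.mapMatrix_apply, Matrix.map_apply, Matrix.add_apply, hsum, map_add, map_sum, hK₀eval]
      simp only [Φ]
      have hterm : ∀ i, MvPolynomial.eval ω (if v i then K' i a b else 0) =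
          (if v i then (if (a, b) ∈ P i then ω (some i, (a, b)) else 0) else 0) -
            (if v i then (if (b, a) ∈ P i then ω (some i, (b, a)) else 0) else 0) := by
        intro i
        by_cases hvi : v i = true
        · simp [hvi, hK'eval]
        · simp [hvi]
      simp only [hterm, Finset.sum_sub_distrib]
      ring
    -- structure of `E`: skew, supported on `b = σ a`, `±1` there
    have hEba : ∀ a b, E b a = -E a b := fun a b => by simp only [E]; ring
    have hCL_σ : ∀ a b, (a, b) ∈ CL → b = σ a := by
      rintro a b ⟨a₀, -, hc⟩
      rcases hwit_cell a₀ with h | h <;> rw [h] at hc <;> simp only [Prod.mk.injEq] at hc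
      · obtain ⟨rfl, rfl⟩ := hc; rfl
      · obtain ⟨rfl, rfl⟩ := hc; exact (hσσ a₀).symm
    have hE_off : ∀ a b, b ≠ σ a → E a b = 0 := by
      intro a b hb
      have h1 : (a, b) ∉ CL := fun h => hb (hCL_σ a b h)
      have h2 : (b, a) ∉ CL := fun h => hb (by rw [hCL_σ b a h, hσσ])
      simp only [E, h1, h2, if_false, sub_self]
    have hE_sq : ∀ a, E a (σ a) * E a (σ a) = 1 := by
      intro a
      -- the representative of the edge `{a, σ a}`
      obtain ⟨r, hr, hrcell⟩ : ∃ r, r < σ r ∧ ((wit r).2 = (a, σ a) ∨ (wit r).2 = (σ a, a)) := by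
        rcases lt_or_gt_of_ne (hne a) with h | h
        · exact ⟨a, h, hwit_cell a⟩
        · refine ⟨σ a, by rw [hσσ]; exact h, ?_⟩
          rcases hwit_cell (σ a) with h' | h' <;> rw [h', hσσ]
          · exact Or.inr rfl
          · exact Or.inl rfl
      have hone : (a, σ a) ∈ CL ∨ (σ a, a) ∈ CL := by
        rcases hrcell with h | h
        · exact Or.inl ⟨r, hr, h⟩
        · exact Or.inr ⟨r, hr, h⟩
      have hnotboth : ¬ ((a, σ a) ∈ CL ∧ (σ a, a) ∈ CL) := by
        rintro ⟨⟨a₁, ha₁, h₁⟩, ⟨a₂, ha₂, h₂⟩⟩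
        -- both representatives are the smaller endpoint of `{a, σ a}`
        have key : ∀ a' : Fin d, a' < σ a' → ((wit a').2 = (a, σ a) ∨ (wit a').2 = (σ a, a)) → a' = r := by
          intro a' ha' hc'
          have hends : ∀ x : Fin d, x < σ x → ((wit x).2 = (a, σ a) ∨ (wit x).2 = (σ a, a)) → (x = a ∨ x = σ a) := by
            intro x hx hcx
            rcases hwit_cell x with h | h <;> rcases hcx with h' | h' <;> rw [h] at h' <;>
              simp only [Prod.mk.injEq] at h'
            · exact Or.inl h'.1
            · exact Or.inr h'.1
            · exact Or.inr h'.2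
            · exact Or.inl h'.2
          rcases hends a' ha' hc' with rfl | rfl <;> rcases hends r hr hrcell with h | h
          · exact h.symm
          · exfalso; rw [h, hσσ] at hr; exact lt_asymm ha' hr
          · exfalso; rw [h] at hr; rw [hσσ] at ha'; exact lt_asymm ha' hr
          · exact h.symm
        have e1 := key a₁ ha₁ (Or.inl h₁)
        have e2 := key a₂ ha₂ (Or.inr h₂)
        subst e1; subst e2
        rw [h₁] at h₂
        simp only [Prod.mk.injEq] at h₂
        exact hne a h₂.1
      simp only [E]
      rcases hone with h | h
      · have h' : (σ a, a) ∉ CL := fun h'' => hnotboth ⟨h, h''⟩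
        simp [h, h']
      · have h' : (a, σ a) ∉ CL := fun h'' => hnotboth ⟨h'', h⟩
        simp [h, h']
    -- `E² = -1`, so `det E ≠ 0`
    have hEE : (Matrix.of E) * (Matrix.of E) = -1 := by
      ext a c
      rw [Matrix.mul_apply, Finset.sum_eq_single (σ a)]
      · simp only [Matrix.of_apply, Matrix.neg_apply]
        by_cases hca : c = a
        · subst hca
          rw [Matrix.one_apply_eq, hEba c (σ c)]
          have := hE_sq c
          linear_combination (-1 : ℚ) * this
        · rw [Matrix.one_apply_ne (Ne.symm hca), hE_off (σ a) c (by rw [hσσ]; exact hca), mul_zero, neg_zero]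
      · intro b _ hb
        simp only [Matrix.of_apply]
        rw [hE_off a b hb, zero_mul]
      · simp
    intro h0
    have hmat : (RingHom.mapMatrix (MvPolynomial.eval ω)) (K₀' + ∑ i, if v i then K' i else 0) = Matrix.of E := by
      ext a b
      rw [hentry]
      rfl
    have h1 := congrArg (MvPolynomial.eval ω) h0
    rw [RingHom.map_det, map_zero, hmat] at h1
    have h2 := congrArg Matrix.det hEE
    rw [Matrix.det_mul, h1, zero_mul, Matrix.det_neg, Matrix.det_one, mul_one] at h2
    exact (pow_ne_zero _ (by norm_num : (-1 : ℚ) ≠ 0)) h2.symm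
  · -- no perfect matching: the skew symbolic matrix supported on the live graph is singular
    intro hrank
    by_contra hno
    push Not at hno
    set Mv := symbolicMatrix (K₀'.map ι) (fun i => (K' i).map ι) v with hMv
    -- characteristic zero
    haveI : CharZero L := charZero_of_injective_algebraMap hι
    haveI : CharZero (FractionRing (MvPolynomial (Fin n) L)) :=
      charZero_of_injective_algebraMap (IsFractionRing.injective (MvPolynomial (Fin n) L) _)
    have h2 : (2 : FractionRing (MvPolynomial (Fin n) L)) ≠ 0 := two_ne_zero
    -- entries of `Mv`
    have hentryMv : ∀ a b, Mv a b = algebraMap L (FractionRing (MvPolynomial (Fin n) L)) (ι (K₀' a b)) +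
        ∑ i, if v i then (algebraMap (MvPolynomial (Fin n) L) (FractionRing (MvPolynomial (Fin n) L)) (MvPolynomial.X i)) *
          algebraMap L (FractionRing (MvPolynomial (Fin n) L)) (ι (K' i a b)) else 0 := by
      intro a b
      simp only [hMv, symbolicMatrix, Matrix.add_apply, Matrix.map_apply, Matrix.sum_apply]
      congr 1
      refine Finset.sum_congr rfl fun i _ => ?_
      split_ifs <;> simp [Matrix.smul_apply, Matrix.map_apply]
    have hskew : Matrix.transpose Mv = -Mv := by
      ext a b
      rw [Matrix.transpose_apply, Matrix.neg_apply, hentryMv b a, hentryMv a b, hK₀ba, map_neg, map_neg, neg_add,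
        ← Finset.sum_neg_distrib]
      congr 1
      refine Finset.sum_congr rfl fun i _ => ?_
      rw [hK'ba, map_neg, map_neg]
      split_ifs <;> ring
    have hsupp : ∀ a b, Mv a b ≠ 0 → (SimpleGraph.fromRel fun a b : Fin d =>
        (a, b) ∈ {x : Fin d × Fin d | x ∈ P₀ ∨ ∃ i, v i = true ∧ x ∈ P i}).Adj a b := by
      intro a b hab
      by_contra hnadj
      apply hab
      rw [SimpleGraph.fromRel_adj, not_and_or, not_or] at hnadj
      apply symbolicMatrix_entry_eq_zero
      · rw [Matrix.map_apply]
        rcases hnadj with h | ⟨h1, h2⟩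
        · rw [not_ne_iff] at h
          subst h
          simp [K₀']
        · simp only [Set.mem_setOf_eq, not_or, not_exists, not_and] at h1 h2
          simp [K₀', Set.indicator_of_notMem h1.1, Set.indicator_of_notMem h2.1]
      · intro i hi
        rw [Matrix.map_apply]
        rcases hnadj with h | ⟨h1, h2⟩
        · rw [not_ne_iff] at h
          subst h
          simp [K']
        · simp only [Set.mem_setOf_eq, not_or, not_exists, not_and] at h1 h2
          simp [K', Set.indicator_of_notMem (h1.2 i hi), Set.indicator_of_notMem (h2.2 i hi)]
    have hdet := det_eq_zero_of_forall_not_isPerfectMatching h2 _ Mv hskew hsupp hno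
    obtain ⟨r, c, hrc⟩ := (Literature.LinearAlgebra.Matrix.le_rank_iff_exists_det_submatrix_ne_zero Mv).1 hrank
    exact hrc (det_submatrix_eq_zero_of_det_eq_zero Mv hdet r c)

/-- **`TUTTE_d ⊆ GRANK_d`**: the inline class of the Tutte door (`…TutteLogWidth`) consists of GRANK gates of dimension `≤ d`
(`isGRankGate_of_tutteGate`). [folklore] -/
theorem tutte_subset_gRank (d : ℕ) :
    {g : GateFn | ∃ d' : ℕ, d' ≤ d ∧ ∃ (P₀ : Set (Fin d' × Fin d')) (P : Fin g.1 → Set (Fin d' × Fin d')),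
      ∀ v : Fin g.1 → Bool, g.2 v = true ↔
        ∃ M : (SimpleGraph.fromRel fun a b : Fin d' =>
          (a, b) ∈ {x : Fin d' × Fin d' | x ∈ P₀ ∨ ∃ i, v i = true ∧ x ∈ P i}).Subgraph, M.IsPerfectMatching} ⊆
    {g : GateFn | IsGRankGate d g} := by
  rintro ⟨k, f⟩ ⟨d', hd', P₀, P, hf⟩
  exact isGRankGate_of_tutteGate hd' P₀ P hf

end Summit.PneNP.PneNP.Theorems
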